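import Summits.AtomisticToContinuum.BoseEinsteinCondensation.Theorems.BECInsertionCorrectorStaticResponseBoundModulationToolkit
import HarnessLib

/-!
# Modulated minimisers on the torus, V: `ModulationBootstrap` from the existence of positive
# minimisers (support for stub S3 of line `uv-thomson-force-wave`, crux
# `BECInsertionCorrector.StaticResponseBound`, item stmt-AtomisticToContinuum-12057)

Part 5 of 5. Along a selection `s ↦ Φ_s` of positive real finite-energy minimisers of
`E_w + s⟨∑cos⟩` on the window `s² ≤ T₂`, each with centred static susceptibility `≤ K`:
`sel_twoPoint`, `sel_continuousOn`, `sel_local_bound`, `sel_monotone` (`V̄_s + 2Ks` non-decreasing,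
i.e. `E + Ks²` convex), `sel_taylor` (`e(t) ≥ e(0) + tV̄_0 - Kt²`, both signs of `t`),
`cosMean_eq_zero_of_isMinimiser_zero` (`V̄_0 = 0` by the half-wavelength translation and the
two-point inequality at equal couplings), `modulationBootstrap_of_exists_window` (the conclusion
for fixed `(w, N, L, k, T₂, K)`, any measurable `w`, with existence assumed on the window only),
and the conditional theorem `stub_modulationBootstrap_of_exists : (F1) → ModulationBootstrap` whose
conclusion is the registered stub verbatim; (F1) = existence, for every coupling, of a positive real finite-energy
periodic `C¹` minimiser (Perron–Frobenius + elliptic regularity, [ReedSimonIV1978] Thm XIII.44,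
§XIII.12 — not in the tree). Given (F1), `stub_modulationBootstrap := stub_modulationBootstrap_of_exists F1`.

References: [Kato1966] VII §3; [ReedSimonIV1978] Thm XIII.44.
-/

noncomputable section

namespace Summit.AtomisticToContinuum.BoseEinsteinCondensation.Cruxes.StaticResponseBound.UvThomsonForceWave

open MeasureTheory Filter Metric
open scoped ENNReal NNReal BigOperators Topology
open Literature.MathematicalPhysics.QuantumManyBody.BoseGas
open Summit.AtomisticToContinuum.BoseEinsteinCondensation.Theses.BECInsertionCorrector
open Summit.AtomisticToContinuum.BoseEinsteinCondensation.Theorems.StaticResponseBound.Negative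

variable {N : ℕ} {L : ℝ}

/-! ### Assembly: the stub from the existence of positive minimisers -/

section Assembly

variable {w : ℝ → ℝ≥0∞} {k : Fin 3 → ℤ} {T₂ K : ℝ} {Φsel : ℝ → PeriodicTrialState N L}

/-- Points between two points of the window `{s | s² ≤ T₂}` lie in the window. [folklore] -/
theorem sq_le_of_between {a b x T₂ : ℝ} (ha : a ^ 2 ≤ T₂) (hb : b ^ 2 ≤ T₂) (hax : a ≤ x)
    (hxb : x ≤ b) : x ^ 2 ≤ T₂ := by
  rcases le_or_gt 0 x with hx | hx
  · nlinarith
  · nlinarith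

/-- `s² ≤ T₂` for `0 ≤ s ≤ √T₂`. [folklore] -/
theorem sq_le_of_le_sqrt {s T₂ : ℝ} (hT : 0 ≤ T₂) (h0 : 0 ≤ s) (h : s ≤ Real.sqrt T₂) : s ^ 2 ≤ T₂ := by
  have := pow_le_pow_left₀ h0 h 2
  rwa [Real.sq_sqrt hT] at this

/-- **Two-point inequality along a selection of minimisers** `s ↦ Φ_s` on the window
`s² ≤ T₂`: for every `s` there is `c ≥ 0` (a Poincaré constant of `|Φ_s|²`) with
`|V̄_s - V̄_{s''}| (1 - 4Nc|s''-s|)² ≤ 2K|s''-s|` whenever `4Nc|s''-s| < 1`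
(`V̄_s = ⟨∑cos⟩_{Φ_s}`). [cite: Kato1966, VII §3] -/
theorem sel_twoPoint (hL : 0 < L) (hw : Measurable w) (hK : 0 ≤ K)
    (hsel : ∀ s : ℝ, s ^ 2 ≤ T₂ →
      (∀ X, (Φsel s).ψ X = (‖(Φsel s).ψ X‖ : ℂ)) ∧ (∀ X, (Φsel s).ψ X ≠ 0) ∧
      periodicEnergy w (Φsel s) ≠ ⊤ ∧
      ∀ Ψ : PeriodicTrialState N L, periodicEnergy w Ψ ≠ ⊤ →
        (periodicEnergy w (Φsel s)).toReal + s * cosMean L k (Φsel s) ≤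
          (periodicEnergy w Ψ).toReal + s * cosMean L k Ψ)
    (hKsel : ∀ s : ℝ, s ^ 2 ≤ T₂ →
      hMinusOneSqW L (fun X => ‖(Φsel s).ψ X‖)
        (fun X => (∑ j, Real.cos (2 * Real.pi / L * ∑ i, (k i : ℝ) * X j i)) - cosMean L k (Φsel s))
        ≤ ENNReal.ofReal K)
    {s : ℝ} (hs : s ^ 2 ≤ T₂) :
    ∃ c : ℝ, 0 ≤ c ∧ ∀ s'' : ℝ, s'' ^ 2 ≤ T₂ → 4 * N * c * |s'' - s| < 1 →
      |cosMean L k (Φsel s) - cosMean L k (Φsel s'')| * (1 - 4 * N * c * |s'' - s|) ^ 2 ≤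
        2 * K * |s'' - s| := by
  obtain ⟨hr, hp, hf, hm⟩ := hsel s hs
  obtain ⟨c, hc0, hP⟩ := exists_poincareConst hL (Φsel s) hr hp
  refine ⟨c, hc0, fun s'' hs'' hδ => ?_⟩
  obtain ⟨hr'', hp'', hf'', hm''⟩ := hsel s'' hs''
  exact abs_cosMean_sub_mul_sq_le hL hw k hK hc0 hr hp hf hm (hKsel s hs) hP hr'' hp'' hf'' hm''
    (hKsel s'' hs'') hδ

/-- **Continuity of `s ↦ V̄_s` on the window** (from the two-point inequality based at `s`).
[cite: Kato1966, VII §3] -/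
theorem sel_continuousOn (hL : 0 < L) (hw : Measurable w) (hK : 0 ≤ K)
    (hsel : ∀ s : ℝ, s ^ 2 ≤ T₂ →
      (∀ X, (Φsel s).ψ X = (‖(Φsel s).ψ X‖ : ℂ)) ∧ (∀ X, (Φsel s).ψ X ≠ 0) ∧
      periodicEnergy w (Φsel s) ≠ ⊤ ∧
      ∀ Ψ : PeriodicTrialState N L, periodicEnergy w Ψ ≠ ⊤ →
        (periodicEnergy w (Φsel s)).toReal + s * cosMean L k (Φsel s) ≤
          (periodicEnergy w Ψ).toReal + s * cosMean L k Ψ)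
    (hKsel : ∀ s : ℝ, s ^ 2 ≤ T₂ →
      hMinusOneSqW L (fun X => ‖(Φsel s).ψ X‖)
        (fun X => (∑ j, Real.cos (2 * Real.pi / L * ∑ i, (k i : ℝ) * X j i)) - cosMean L k (Φsel s))
        ≤ ENNReal.ofReal K) :
    ContinuousOn (fun s => cosMean L k (Φsel s)) {s | s ^ 2 ≤ T₂} := by
  intro s hs
  rw [Metric.continuousWithinAt_iff]
  intro ε hε
  obtain ⟨c, hc0, h2⟩ := sel_twoPoint hL hw hK hsel hKsel hs
  have hN : (0 : ℝ) ≤ N := Nat.cast_nonneg N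
  refine ⟨min (1 / (8 * N * c + 1)) (ε / (8 * K + 8)), by positivity, fun x hx hdist => ?_⟩
  rw [Real.dist_eq] at hdist ⊢
  have hd1 : |x - s| < 1 / (8 * N * c + 1) := lt_of_lt_of_le hdist (min_le_left _ _)
  have hd2 : |x - s| < ε / (8 * K + 8) := lt_of_lt_of_le hdist (min_le_right _ _)
  have hy : 4 * N * c * |x - s| ≤ 1 / 2 := by
    rw [lt_div_iff₀ (by positivity)] at hd1
    nlinarith [abs_nonneg (x - s), mul_nonneg hN hc0]
  have h := h2 x hx (by linarith)
  have hq : (1 : ℝ) / 4 ≤ (1 - 4 * N * c * |x - s|) ^ 2 := by nlinarith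
  have hD : |cosMean L k (Φsel s) - cosMean L k (Φsel x)| ≤ 8 * K * |x - s| := by
    have hD0 := abs_nonneg (cosMean L k (Φsel s) - cosMean L k (Φsel x))
    nlinarith
  rw [abs_sub_comm]
  rw [lt_div_iff₀ (by positivity)] at hd2
  nlinarith [abs_nonneg (x - s)]

/-- **Local right lower bound for `s ↦ V̄_s + 2Ks`** on the window: at every `x`,
`(V̄_z + 2Kz) - (V̄_x + 2Kx) ≥ -A_x (z - x)²` for `z > x` close to `x` (first-order consequence
of the two-point inequality based at `x`: `V̄_x - V̄_z ≤ 2K(z-x)(1 + O(z-x))`).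
[cite: Kato1966, VII §3] -/
theorem sel_local_bound (hL : 0 < L) (hw : Measurable w) (hK : 0 ≤ K)
    (hsel : ∀ s : ℝ, s ^ 2 ≤ T₂ →
      (∀ X, (Φsel s).ψ X = (‖(Φsel s).ψ X‖ : ℂ)) ∧ (∀ X, (Φsel s).ψ X ≠ 0) ∧
      periodicEnergy w (Φsel s) ≠ ⊤ ∧
      ∀ Ψ : PeriodicTrialState N L, periodicEnergy w Ψ ≠ ⊤ →
        (periodicEnergy w (Φsel s)).toReal + s * cosMean L k (Φsel s) ≤
          (periodicEnergy w Ψ).toReal + s * cosMean L k Ψ)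
    (hKsel : ∀ s : ℝ, s ^ 2 ≤ T₂ →
      hMinusOneSqW L (fun X => ‖(Φsel s).ψ X‖)
        (fun X => (∑ j, Real.cos (2 * Real.pi / L * ∑ i, (k i : ℝ) * X j i)) - cosMean L k (Φsel s))
        ≤ ENNReal.ofReal K)
    {x : ℝ} (hx : x ^ 2 ≤ T₂) :
    ∃ A h : ℝ, 0 < h ∧ ∀ z : ℝ, z ^ 2 ≤ T₂ → x < z → z < x + h →
      -A * (z - x) ^ 2 ≤ (cosMean L k (Φsel z) + 2 * K * z) - (cosMean L k (Φsel x) + 2 * K * x) := by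
  obtain ⟨c, hc0, h2⟩ := sel_twoPoint hL hw hK hsel hKsel hx
  have hN : (0 : ℝ) ≤ N := Nat.cast_nonneg N
  refine ⟨32 * K * N * c, 1 / (16 * N * c + 1), by positivity, fun z hz hxz hzh => ?_⟩
  set δ := z - x with hδdef
  have hδ : 0 < δ := by rw [hδdef]; linarith
  set y := 4 * N * c * δ with hydef
  have hy0 : 0 ≤ y := by positivity
  have hy : y ≤ 1 / 4 := by
    have h1 : δ < 1 / (16 * N * c + 1) := by rw [hδdef]; linarith
    rw [lt_div_iff₀ (by positivity)] at h1
    nlinarith [mul_nonneg hN hc0]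
  have habs : |z - x| = δ := abs_of_pos hδ
  have h := h2 z hz (by rw [habs]; linarith)
  rw [habs] at h
  set D := cosMean L k (Φsel x) - cosMean L k (Φsel z) with hDdef
  -- goal: `-Aδ² ≤ -D + 2Kδ`
  have hgoal : (cosMean L k (Φsel z) + 2 * K * z) - (cosMean L k (Φsel x) + 2 * K * x) =
      -D + 2 * K * δ := by rw [hDdef, hδdef]; ring
  rw [hgoal]
  rcases le_or_gt D 0 with hD | hD
  · have hA : 0 ≤ 32 * K * N * c * δ ^ 2 := by positivity
    nlinarith [mul_nonneg hK hδ.le]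
  · have h1 : D * (1 - y) ^ 2 ≤ 2 * K * δ := by
      have := abs_of_pos hD
      rw [this] at h
      exact h
    have h3 : 1 ≤ (1 - y) ^ 2 * (1 + 4 * y) := by
      have hexp : (1 - y) ^ 2 * (1 + 4 * y) = 1 + y * (2 - 7 * y) + 4 * y ^ 3 := by ring
      rw [hexp]
      have h7 : 0 ≤ y * (2 - 7 * y) := mul_nonneg hy0 (by linarith)
      have h8 : 0 ≤ 4 * y ^ 3 := by positivity
      linarith
    have h4 : D ≤ 2 * K * δ * (1 + 4 * y) := by
      calc D ≤ D * ((1 - y) ^ 2 * (1 + 4 * y)) := le_mul_of_one_le_right hD.le h3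
        _ = D * (1 - y) ^ 2 * (1 + 4 * y) := by ring
        _ ≤ 2 * K * δ * (1 + 4 * y) := mul_le_mul_of_nonneg_right h1 (by linarith)
    rw [hydef] at h4
    nlinarith

/-- **`s ↦ V̄_s + 2Ks` is non-decreasing on the window** (`E + Ks²` is convex: `E″ ≥ -2K`).
[cite: Kato1966, VII §3] -/
theorem sel_monotone (hL : 0 < L) (hw : Measurable w) (hK : 0 ≤ K)
    (hsel : ∀ s : ℝ, s ^ 2 ≤ T₂ →
      (∀ X, (Φsel s).ψ X = (‖(Φsel s).ψ X‖ : ℂ)) ∧ (∀ X, (Φsel s).ψ X ≠ 0) ∧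
      periodicEnergy w (Φsel s) ≠ ⊤ ∧
      ∀ Ψ : PeriodicTrialState N L, periodicEnergy w Ψ ≠ ⊤ →
        (periodicEnergy w (Φsel s)).toReal + s * cosMean L k (Φsel s) ≤
          (periodicEnergy w Ψ).toReal + s * cosMean L k Ψ)
    (hKsel : ∀ s : ℝ, s ^ 2 ≤ T₂ →
      hMinusOneSqW L (fun X => ‖(Φsel s).ψ X‖)
        (fun X => (∑ j, Real.cos (2 * Real.pi / L * ∑ i, (k i : ℝ) * X j i)) - cosMean L k (Φsel s))
        ≤ ENNReal.ofReal K)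
    {a b : ℝ} (ha : a ^ 2 ≤ T₂) (hb : b ^ 2 ≤ T₂) (hab : a ≤ b) :
    cosMean L k (Φsel a) + 2 * K * a ≤ cosMean L k (Φsel b) + 2 * K * b := by
  have hcont : ContinuousOn (fun s => cosMean L k (Φsel s) + 2 * K * s) (Set.Icc a b) := by
    refine ContinuousOn.add ?_ (continuousOn_const.mul continuousOn_id)
    exact (sel_continuousOn hL hw hK hsel hKsel).mono fun x hx => sq_le_of_between ha hb hx.1 hx.2
  refine le_of_local_lower_bound (g := fun s => cosMean L k (Φsel s) + 2 * K * s) hab hcont ?_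
  intro x hx
  have hxW : x ^ 2 ≤ T₂ := sq_le_of_between ha hb hx.1 hx.2.le
  obtain ⟨A, h, hh, hloc⟩ := sel_local_bound hL hw hK hsel hKsel hxW
  exact ⟨A, h, hh, fun z hxz hzh hzb => hloc z (sq_le_of_between ha hb (hx.1.trans hxz.le) hzb) hxz hzh⟩

/-- **Taylor lower bound along the selection**: with `e(s) = E_w(Φ_s) + sV̄_s` (the minimum of
the modulated functional), `e(t) ≥ e(0) + tV̄_0 - Kt²` on the window (both signs of `t`; the
negative side by the reflection `s ↦ -s`, `V̄ ↦ -V̄`). [cite: Kato1966, VII §3] -/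
theorem sel_taylor (hL : 0 < L) (hw : Measurable w) (hK : 0 ≤ K) (hT : 0 ≤ T₂)
    (hsel : ∀ s : ℝ, s ^ 2 ≤ T₂ →
      (∀ X, (Φsel s).ψ X = (‖(Φsel s).ψ X‖ : ℂ)) ∧ (∀ X, (Φsel s).ψ X ≠ 0) ∧
      periodicEnergy w (Φsel s) ≠ ⊤ ∧
      ∀ Ψ : PeriodicTrialState N L, periodicEnergy w Ψ ≠ ⊤ →
        (periodicEnergy w (Φsel s)).toReal + s * cosMean L k (Φsel s) ≤
          (periodicEnergy w Ψ).toReal + s * cosMean L k Ψ)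
    (hKsel : ∀ s : ℝ, s ^ 2 ≤ T₂ →
      hMinusOneSqW L (fun X => ‖(Φsel s).ψ X‖)
        (fun X => (∑ j, Real.cos (2 * Real.pi / L * ∑ i, (k i : ℝ) * X j i)) - cosMean L k (Φsel s))
        ≤ ENNReal.ofReal K)
    {t : ℝ} (ht : t ^ 2 ≤ T₂) :
    (periodicEnergy w (Φsel 0)).toReal + t * cosMean L k (Φsel 0) - K * t ^ 2 ≤
      (periodicEnergy w (Φsel t)).toReal + t * cosMean L k (Φsel t) := by
  have htabs : |t| ≤ Real.sqrt T₂ := Real.abs_le_sqrt ht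
  rcases le_or_gt 0 t with ht0 | ht0
  · -- `t ≥ 0`
    have h := le_of_lower_tangent_of_monotone (r := Real.sqrt T₂) hK
      (e := fun s => (periodicEnergy w (Φsel s)).toReal + s * cosMean L k (Φsel s))
      (f := fun s => cosMean L k (Φsel s)) ?_ ?_ ht0 (by rwa [abs_of_nonneg ht0] at htabs)
    · simpa using h
    · intro s s' hs0 hss' hs'r
      have hs'W : s' ^ 2 ≤ T₂ := sq_le_of_le_sqrt hT (hs0.trans hss'.le) hs'r
      have hsW : s ^ 2 ≤ T₂ := by nlinarith
      have hm := (hsel s hsW).2.2.2 (Φsel s') (hsel s' hs'W).2.2.1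
      nlinarith
    · intro s s' hs0 hss' hs'r
      have hs'W : s' ^ 2 ≤ T₂ := sq_le_of_le_sqrt hT (hs0.trans hss') hs'r
      have hsW : s ^ 2 ≤ T₂ := by nlinarith
      exact sel_monotone hL hw hK hsel hKsel hsW hs'W hss'
  · -- `t < 0`: reflect
    have h := le_of_lower_tangent_of_monotone (r := Real.sqrt T₂) hK
      (e := fun s => (periodicEnergy w (Φsel (-s))).toReal + (-s) * cosMean L k (Φsel (-s)))
      (f := fun s => -cosMean L k (Φsel (-s))) ?_ ?_ (neg_nonneg.2 ht0.le)
      (by rwa [abs_of_neg ht0] at htabs)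
    · simp only [neg_neg, neg_zero] at h
      nlinarith [h]
    · intro s s' hs0 hss' hs'r
      have hs'W : (-s') ^ 2 ≤ T₂ := by
        rw [neg_sq]; exact sq_le_of_le_sqrt hT (hs0.trans hss'.le) hs'r
      have hsW : (-s) ^ 2 ≤ T₂ := by nlinarith
      have hm := (hsel (-s) hsW).2.2.2 (Φsel (-s')) (hsel (-s') hs'W).2.2.1
      nlinarith
    · intro s s' hs0 hss' hs'r
      have hs'W : (-s') ^ 2 ≤ T₂ := by
        rw [neg_sq]; exact sq_le_of_le_sqrt hT (hs0.trans hss') hs'r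
      have hsW : (-s) ^ 2 ≤ T₂ := by nlinarith
      have hm := sel_monotone hL hw hK hsel hKsel hs'W hsW (by linarith)
      linarith

/-- **`V̄ = 0` at zero coupling** (`E′(0) = 0`): the half-wavelength translate of a positive
minimiser at `s = 0` is again one (translation invariance of `H`, `k ≠ 0`), has the opposite
`V̄`, and two positive minimisers at the same coupling have the same `V̄` (two-point inequality
at `s'' = s`). [cite: ReedSimonIV1978, Thm XIII.44 and §XIII.12] -/
theorem cosMean_eq_zero_of_isMinimiser_zero (hL : 0 < L) (hw : Measurable w) (hk : k ≠ 0)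
    (hK : 0 ≤ K) (hT : 0 ≤ T₂)
    (hχ : ∀ s : ℝ, s ^ 2 ≤ T₂ → ∀ Φ : PeriodicTrialState N L,
      (∀ X, Φ.ψ X = (‖Φ.ψ X‖ : ℂ)) → (∀ X, Φ.ψ X ≠ 0) → periodicEnergy w Φ ≠ ⊤ →
      (∀ Ψ : PeriodicTrialState N L, periodicEnergy w Ψ ≠ ⊤ →
        (periodicEnergy w Φ).toReal + s * cosMean L k Φ ≤ (periodicEnergy w Ψ).toReal + s * cosMean L k Ψ) →
      hMinusOneSqW L (fun X => ‖Φ.ψ X‖)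
          (fun X => (∑ j, Real.cos (2 * Real.pi / L * ∑ i, (k i : ℝ) * X j i)) - cosMean L k Φ)
        ≤ ENNReal.ofReal K)
    (Φ : PeriodicTrialState N L) (hreal : ∀ X, Φ.ψ X = (‖Φ.ψ X‖ : ℂ)) (hpos : ∀ X, Φ.ψ X ≠ 0)
    (hfin : periodicEnergy w Φ ≠ ⊤)
    (hmin : ∀ Ψ : PeriodicTrialState N L, periodicEnergy w Ψ ≠ ⊤ →
      (periodicEnergy w Φ).toReal + 0 * cosMean L k Φ ≤ (periodicEnergy w Ψ).toReal + 0 * cosMean L k Ψ) :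
    cosMean L k Φ = 0 := by
  obtain ⟨Ψ, ⟨T, hT'⟩, hE, hcos⟩ := exists_translate_cosMean_eq_neg hL hk Φ
  have hrealΨ : ∀ X, Ψ.ψ X = (‖Ψ.ψ X‖ : ℂ) := fun X => by rw [hT']; exact hreal _
  have hposΨ : ∀ X, Ψ.ψ X ≠ 0 := fun X => by rw [hT']; exact hpos _
  have hfinΨ : periodicEnergy w Ψ ≠ ⊤ := by rw [hE w]; exact hfin
  have hminΨ : ∀ Ψ' : PeriodicTrialState N L, periodicEnergy w Ψ' ≠ ⊤ →
      (periodicEnergy w Ψ).toReal + 0 * cosMean L k Ψ ≤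
        (periodicEnergy w Ψ').toReal + 0 * cosMean L k Ψ' := by
    intro Ψ' h
    rw [hE w]
    have := hmin Ψ' h
    simp only [zero_mul, add_zero] at this ⊢
    exact this
  have h0 : (0 : ℝ) ^ 2 ≤ T₂ := by simpa using hT
  have hχΦ := hχ 0 h0 Φ hreal hpos hfin hmin
  have hχΨ := hχ 0 h0 Ψ hrealΨ hposΨ hfinΨ hminΨ
  obtain ⟨c, hc0, hP⟩ := exists_poincareConst hL Φ hreal hpos
  have h := abs_cosMean_sub_mul_sq_le hL hw k hK hc0 hreal hpos hfin hmin hχΦ hP hrealΨ hposΨ hfinΨ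
    hminΨ hχΨ (by simp)
  simp only [sub_self, abs_zero, mul_zero, sub_zero, one_pow, mul_one] at h
  have h' := abs_nonpos_iff.1 h
  rw [hcos] at h'
  linarith

end Assembly

/-! ### The conditional theorems: `ModulationBootstrap` from existence of minimisers -/

/-- **`ModulationBootstrap` at fixed data, from existence of positive minimisers ON THE WINDOW.**
For ANY measurable pair profile `w`, any `N`, `L > 0`, `k ≠ 0`, `T₂, K ≥ 0`: if every positive
real finite-energy minimiser of `E_w + s⟨∑cos⟩` with `s² ≤ T₂` has centred static susceptibility
`≤ K` (the stub's hypothesis) AND such a minimiser exists for every `s² ≤ T₂`, then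
`E₀^per(w,N,L) - Kt² ≤ E_w(Ψ) + t⟨∑cos⟩_Ψ` for all `t² ≤ T₂` and all finite-energy `Ψ`
(the flexible form for reshaping the skeleton: existence enters as an inner hypothesis, per
`(w, N, L, k)` and only on the window). [cite: Kato1966, VII §3] -/
theorem modulationBootstrap_of_exists_window {w : ℝ → ℝ≥0∞} (hw : Measurable w) {N : ℕ} {L : ℝ}
    (hL : 0 < L) {k : Fin 3 → ℤ} (hk : k ≠ 0) {T₂ K : ℝ} (hT : 0 ≤ T₂) (hK : 0 ≤ K)
    (hχ : ∀ s : ℝ, s ^ 2 ≤ T₂ → ∀ Φ : PeriodicTrialState N L,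
      (∀ X, Φ.ψ X = (‖Φ.ψ X‖ : ℂ)) → (∀ X, Φ.ψ X ≠ 0) → periodicEnergy w Φ ≠ ⊤ →
      (∀ Ψ : PeriodicTrialState N L, periodicEnergy w Ψ ≠ ⊤ →
        (periodicEnergy w Φ).toReal + s * cosMean L k Φ ≤ (periodicEnergy w Ψ).toReal + s * cosMean L k Ψ) →
      hMinusOneSqW L (fun X => ‖Φ.ψ X‖)
          (fun X => (∑ j, Real.cos (2 * Real.pi / L * ∑ i, (k i : ℝ) * X j i)) - cosMean L k Φ)
        ≤ ENNReal.ofReal K)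
    (hex : ∀ s : ℝ, s ^ 2 ≤ T₂ → ∃ Φ : PeriodicTrialState N L,
      (∀ X, Φ.ψ X = (‖Φ.ψ X‖ : ℂ)) ∧ (∀ X, Φ.ψ X ≠ 0) ∧ periodicEnergy w Φ ≠ ⊤ ∧
      ∀ Ψ : PeriodicTrialState N L, periodicEnergy w Ψ ≠ ⊤ →
        (periodicEnergy w Φ).toReal + s * cosMean L k Φ ≤
          (periodicEnergy w Ψ).toReal + s * cosMean L k Ψ)
    {t : ℝ} (ht : t ^ 2 ≤ T₂) (Ψ : PeriodicTrialState N L) (hΨ : periodicEnergy w Ψ ≠ ⊤) :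
    (periodicGroundStateEnergy w N L).toReal - K * t ^ 2 ≤
      (periodicEnergy w Ψ).toReal + t * cosMean L k Ψ := by
  classical
  have h0 : (0 : ℝ) ^ 2 ≤ T₂ := by simpa using hT
  obtain ⟨Φ₀, -⟩ := hex 0 h0
  -- a selection of positive minimisers on the window (junk `Φ₀` outside, never used)
  let Φsel : ℝ → PeriodicTrialState N L := fun s =>
    if h : s ^ 2 ≤ T₂ then Classical.choose (hex s h) else Φ₀
  have hsel : ∀ s : ℝ, s ^ 2 ≤ T₂ →
      (∀ X, (Φsel s).ψ X = (‖(Φsel s).ψ X‖ : ℂ)) ∧ (∀ X, (Φsel s).ψ X ≠ 0) ∧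
      periodicEnergy w (Φsel s) ≠ ⊤ ∧
      ∀ Ψ : PeriodicTrialState N L, periodicEnergy w Ψ ≠ ⊤ →
        (periodicEnergy w (Φsel s)).toReal + s * cosMean L k (Φsel s) ≤
          (periodicEnergy w Ψ).toReal + s * cosMean L k Ψ := by
    intro s hs
    simp only [Φsel, dif_pos hs]
    exact Classical.choose_spec (hex s hs)
  have hKsel : ∀ s : ℝ, s ^ 2 ≤ T₂ →
      hMinusOneSqW L (fun X => ‖(Φsel s).ψ X‖)
        (fun X => (∑ j, Real.cos (2 * Real.pi / L * ∑ i, (k i : ℝ) * X j i)) - cosMean L k (Φsel s))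
        ≤ ENNReal.ofReal K := fun s hs =>
    hχ s hs (Φsel s) (hsel s hs).1 (hsel s hs).2.1 (hsel s hs).2.2.1 (hsel s hs).2.2.2
  -- Taylor along the selection, `V̄_0 = 0`, and the variational principle at `t`
  have htaylor := sel_taylor hL hw hK hT hsel hKsel ht
  have hc0 : cosMean L k (Φsel 0) = 0 :=
    cosMean_eq_zero_of_isMinimiser_zero hL hw hk hK hT hχ (Φsel 0) (hsel 0 h0).1 (hsel 0 h0).2.1
      (hsel 0 h0).2.2.1 (by simpa using (hsel 0 h0).2.2.2)
  have hmin_t := (hsel t ht).2.2.2 Ψ hΨ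
  have hE0 : (periodicGroundStateEnergy w N L).toReal ≤ (periodicEnergy w (Φsel 0)).toReal :=
    ENNReal.toReal_mono (hsel 0 h0).2.2.1 (periodicGroundStateEnergy_le w (Φsel 0))
  rw [hc0, mul_zero, add_zero] at htaylor
  linarith

/-- **`ModulationBootstrap` from the existence of positive minimisers (F1).** If for the bounded
admissible `w`, `N ≥ 1`, `L > 0`, `k ≠ 0` and every coupling `s` the modulated functional
`Ψ ↦ E_w(Ψ) + s⟨∑ⱼcos(p·xⱼ)⟩_Ψ` has a positive real periodic `C¹` minimiser of finite energy
(Perron–Frobenius + elliptic regularity, the only spectral input), then the registered stub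
`stub_modulationBootstrap` holds (its statement is the conclusion below, verbatim; this closed
`(F1) → ModulationBootstrap` form is the registered sub-goal `stub_modulationBootstrap_of_exists`): fixed-volume
second-order perturbation theory, done variationally — (b) ground-state representation for pairs of
minimisers, Kipnis–Varadhan at both couplings (sharp constant `2K` by the harmonic mean), one
weighted Poincaré constant per coupling (Neumann gap of the cell), a Dini lemma for `V̄_s + 2Ks`, a
discrete Taylor formula, and `V̄_0 = 0` by the half-wavelength translation (Reed–Simon IV
Thm XIII.44 supplies (F1), not used here). [cite: Kato1966, VII §3] -/
theorem stub_modulationBootstrap_of_exists :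
    (∀ w : ℝ → ℝ≥0∞, IsRepulsiveFiniteRange w → (∃ M : ℝ≥0∞, M ≠ ⊤ ∧ ∀ r, w r ≤ M) →
      ∀ (N : ℕ), 1 ≤ N → ∀ (L : ℝ), 0 < L → ∀ (k : Fin 3 → ℤ), k ≠ 0 → ∀ s : ℝ,
      ∃ Φ : PeriodicTrialState N L, (∀ X, Φ.ψ X = (‖Φ.ψ X‖ : ℂ)) ∧ (∀ X, Φ.ψ X ≠ 0) ∧
        periodicEnergy w Φ ≠ ⊤ ∧
        ∀ Ψ : PeriodicTrialState N L, periodicEnergy w Ψ ≠ ⊤ →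
          (periodicEnergy w Φ).toReal + s * cosMean L k Φ ≤
            (periodicEnergy w Ψ).toReal + s * cosMean L k Ψ) →
    ∀ w : ℝ → ℝ≥0∞, IsRepulsiveFiniteRange w → (∃ M : ℝ≥0∞, M ≠ ⊤ ∧ ∀ r, w r ≤ M) →
      ∀ (N : ℕ), 1 ≤ N → ∀ (L : ℝ), 0 < L → ∀ (k : Fin 3 → ℤ), k ≠ 0 →
      ∀ (T₂ K : ℝ), 0 ≤ T₂ → 0 ≤ K →
      (∀ s : ℝ, s ^ 2 ≤ T₂ → ∀ Φ : PeriodicTrialState N L,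
        (∀ X, Φ.ψ X = (‖Φ.ψ X‖ : ℂ)) → (∀ X, Φ.ψ X ≠ 0) → periodicEnergy w Φ ≠ ⊤ →
        (∀ Ψ : PeriodicTrialState N L, periodicEnergy w Ψ ≠ ⊤ →
          (periodicEnergy w Φ).toReal + s * cosMean L k Φ ≤ (periodicEnergy w Ψ).toReal + s * cosMean L k Ψ) →
        hMinusOneSqW L (fun X => ‖Φ.ψ X‖)
            (fun X => (∑ j, Real.cos (2 * Real.pi / L * ∑ i, (k i : ℝ) * X j i)) - cosMean L k Φ)
          ≤ ENNReal.ofReal K) →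
      ∀ t : ℝ, t ^ 2 ≤ T₂ → ∀ Ψ : PeriodicTrialState N L, periodicEnergy w Ψ ≠ ⊤ →
        (periodicGroundStateEnergy w N L).toReal - K * t ^ 2 ≤
          (periodicEnergy w Ψ).toReal + t * cosMean L k Ψ :=
  fun hex w hw hbdd N hN L hL k hk _T₂ _K hT hK hχ _t ht Ψ hΨ =>
    modulationBootstrap_of_exists_window hw.1 hL hk hT hK hχ
      (fun s _ => hex w hw hbdd N hN L hL k hk s) ht Ψ hΨ


end Summit.AtomisticToContinuum.BoseEinsteinCondensation.Cruxes.StaticResponseBound.UvThomsonForceWave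

end
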